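import Summits.QuantumFields.YangMills.Theorems.BalabanUVNodesN07NormalisationSymOfRecord
import Summits.QuantumFields.YangMills.Theorems.BalabanUVNodesN07RadialHolCoverLift
import HarnessLib

/-!
# N07 [B11] (= [15] = [Balaban1985Variational]) Sect. F ∕ [I] (0.11) — **IN A `symCd`-AXIAL GAUGE EVERY STAIRCASE TRANSPORTER OF THE BLOCK IS WITHIN `4δ′` OF `1`** whenever the
# stair family is `δ_N`-small and pairwise within `δ′ ≤ 1∕100`: the first link of the junction's (σ2) supplier «the symmetric-convention axial tower is ALMOST radially axial»

Cell `pub-ymgap`, width seat `pub-ymgap-dag-n07-w3` g13 (junction side of the K0 road; (σ2) of the junction's list, part (Σ-c1)).  `--kind proof --supports stmt-QuantumFields-20541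
--as helper` (K0⁷; count-neutral; THEOREMS ONLY, 0 `def`).  [I] = [Balaban1987RG1]; [15] = [Balaban1985Variational]; [3] = [Balaban1985Averaging].
CONSUMED BY NAME: dag-n07-e's `N07NormalisationSymOfRecord.symCd` (`= symContourData federbushSU`, an `abbrev`), MODULE 86 `N07SymContourData.{stairFamily,
symContourData_holTo_of_small}`, `FederbushMean.federbushSU_dist1_le` (the (0.10) mean is `3δ′`-close to the base point), `Setup.AxialGauge`, `TorusGeometry`'s `Site.blockOf_blockSite`.

WHY.  Row 9′ of the def of record (β)∕(β′) reads the torus carrier `w_s` making `M^i(U^{w_s})` axial for the (0.11) AVERAGED contour datum `symCd` (director-ym №311a∕№312a); road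
(B′)'s crown is radially axial on `ℤᵈ`.  The junction's cross term needs the transformation between the two gauges to be (167)-regular, which this seat reduced (✓p753816
`B8ExpMeanLogOscFromPointwiseRec`, p754021 `B8TwoAxialGaugesOscillationRec`) to ONE input: the single-tree (radial staircase) transporters of the `symCd`-axial averaged fields are
within `δ₁(n)` of `1`, `δ₁` geometric in the level.  THIS FILE is the group-average half of that input: `symCd`-axiality says the Federbush MEAN of the `d!` staircase transporters
`{W(Γ^σ_{y,x})}_σ` is `1`; the mean is `3δ′`-close to any member the others are `δ′`-close to ([I] (0.5)–(0.7), `federbushSU_dist1_le`); so every member is `4δ′`-close to `1`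
(`dist1` subadditive).  The pairwise closeness `δ′` (non-abelian Stokes between staircases, from the curvature of the averaged field) and the identification of the radial
staircase with the `ℤᵈ` transcription's tree contour are the next links (NOT here).

WHAT IS PROVED (sorry-free).  §1 ★★ `dist1_stairFamily_le_of_axialGauge_symCd` — for `W` `symCd`-axial at level `n` (`n + 1 ≤ m + K`), a block site `x = blockSite y r ≠ emb y` whose stair
family is `δ_N`-small and within `δ′ ≤ 1∕100` of its member `0`: `dist1 (W(Γ^σ_{y,x})) ≤ 4δ′` for EVERY staircase `σ`; `dist1_stairFamily_zero_le_of_axialGauge_symCd` (the base member: `≤ 3δ′`).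
§2 (v1.1) `stairWord_revPerm_eq_stairRuns_coordsDesc`, ★★ `stairFamily_revPerm_eq_radialHol` (the radial contour of record IS the stair-family member of the reversed axis order — g9's
`radialHol_blockSite_eq_holAt_walk` + `holT_eq_holAt`), ★★★ `dist1_radialHol_le_of_axialGauge_symCd` (§1 at that member: the radial transporter of a `symCd`-axial field is within `4δ′` of `1`).
§3 (v1.2) `dist1_stairFamily_mul_inv_gaugeAct`, ★★ `dist1_stairFamily_mul_inv_iter_gaugeAct`, `familySmall_stairFamily_iter_gaugeAct_iff` — the pairwise stair letter `δ′` and the Federbush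
guard of `M^n(U^{w_s})` are those of ANY gauge copy `M^n(U^u)` (e.g. the Landau copy; [3] (11) iterated, `dist1` conjugation invariant).
HONEST FRAMING: count-neutral helper; (0.11)∕(0.5)–(0.7) bookkeeping — nothing of [I]∕[15]∕[3] asserted or discharged; the curvature input, the staircase Stokes bound and the cover
transcription are NOT produced; `NrmSymPhiOfRecord` ∕ `HThm4RecSym152PhiE(G)` ∕ `HThm4Rec*` UNDISCHARGED; N05 ∕ N07 NOT discharged; K0⁷ ∕ K1⁹ NOT closed; counts unmoved (typed 28∕28 ·
discharged 8∕28); one finite 𝕋⁴ programme at fixed ε — R4 closes the conditional finite-𝕋⁴ rung `BalabanLadder.UV` only; the YM mass gap (Clay) is NOT proved by any of this;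
nothing continuum ∕ ℝ⁴ ∕ OS.  No `def`, no `instance`, no `notation`, no `sorry`.

References: [I] (0.3) p. 252, (0.5)–(0.7), (0.10)–(0.11) p. 253; [15] (147) p. 301; [3] (11) p. 19.
-/

set_option autoImplicit false

noncomputable section

namespace Summit.QuantumFields.YangMills.BalabanUVNodes.N07SymAxialTreeDefect

open Literature.MathematicalPhysics.QuantumFieldTheory.Balaban1983to89
open Literature.MathematicalPhysics.QuantumFieldTheory.Balaban1983to89.Node00
open T4Continuum (T4Family)
open Summit.QuantumFields.YangMills.BalabanUVNodes.N07SymContourData (stairFamily symContourData symContourData_holTo_of_small)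
open Summit.QuantumFields.YangMills.BalabanUVNodes.N07NormalisationSymOfRecord (symCd)

variable {F : T4Family} {N : ℕ} [NeZero N]

/-! ## §1  The staircase transporters of a `symCd`-axial field are near `1` -/

/-- In a `symCd`-axial gauge, at a block site `x = blockSite y r ≠ emb y` (standing range) whose stair family is `δ_N`-small and within `δ′ ≤ 1∕100` of its member `0`, THAT member is
within `3δ′` of `1`: the Federbush mean of the family is `1` by axiality and `3δ′`-close to the member ([I] (0.10)–(0.11), (0.5)–(0.7)).
[cite: Balaban1987RG1, (0.11) p.253, (0.5)–(0.7) p.253; Balaban1985Variational, (147) p.301] -/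
theorem dist1_stairFamily_zero_le_of_axialGauge_symCd {K n : ℕ} (hn : n + 1 ≤ (F.P K).m + (F.P K).K) {W : GaugeField (F.P K) n (SU N)}
    (hax : AxialGauge (symCd F N K n) W) (y : Site (F.P K) (n + 1)) (r : Fin (F.P K).d → Fin (F.P K).L) (hxy : Site.blockSite y r ≠ emb y)
    (hs : FamilySmall (FederbushMean.federbushSU (n := Fin N)).δ (stairFamily W y r)) {δ' : ℝ} (hδ' : δ' ≤ 1 / 100)
    (h' : ∀ i, dist1 (stairFamily W y r i * (stairFamily W y r 0)⁻¹) ≤ δ') :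
    dist1 (stairFamily W y r 0) ≤ 3 * δ' := by
  have hM : (symCd F N K n).holTo W y (Site.blockSite y r) = 1 := hax y _ (Site.blockOf_blockSite hn y r) hxy
  have hM' : (FederbushMean.federbushSU (n := Fin N)).M (stairFamily W y r) = 1 := by
    rw [← symContourData_holTo_of_small (FederbushMean.federbushSU (n := Fin N)) hn W y r hs]
    exact hM
  have h := FederbushMean.federbushSU_dist1_le hs hδ' h'
  rwa [hM', one_mul, GaugeGroup.dist1_inv] at h

/-- ★★ **IN A `symCd`-AXIAL GAUGE EVERY STAIRCASE TRANSPORTER OF THE BLOCK IS WITHIN `4δ′` OF `1`**: under the hypotheses of the previous lemma, `dist1 (W(Γ^σ_{y,x})) ≤ 4δ′` for every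
staircase `σ` (`dist1` is subadditive: `dist1 (U_σ) ≤ dist1 (U_σ·U₀⁻¹) + dist1 (U₀)`).  In particular the radial staircase — the single tree contour of road (B′)'s `ℤᵈ` axial class —
carries a transporter within `4δ′` of `1`: the symmetric-convention axial tower is ALMOST radially axial.
[cite: Balaban1987RG1, (0.3) p.252, (0.11) p.253, (0.5)–(0.7) p.253; Balaban1985Averaging, (11) p.19] -/
theorem dist1_stairFamily_le_of_axialGauge_symCd {K n : ℕ} (hn : n + 1 ≤ (F.P K).m + (F.P K).K) {W : GaugeField (F.P K) n (SU N)}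
    (hax : AxialGauge (symCd F N K n) W) (y : Site (F.P K) (n + 1)) (r : Fin (F.P K).d → Fin (F.P K).L) (hxy : Site.blockSite y r ≠ emb y)
    (hs : FamilySmall (FederbushMean.federbushSU (n := Fin N)).δ (stairFamily W y r)) {δ' : ℝ} (hδ' : δ' ≤ 1 / 100)
    (h' : ∀ i, dist1 (stairFamily W y r i * (stairFamily W y r 0)⁻¹) ≤ δ') :
    ∀ i, dist1 (stairFamily W y r i) ≤ 4 * δ' := by
  have h0 := dist1_stairFamily_zero_le_of_axialGauge_symCd hn hax y r hxy hs hδ' h'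
  intro i
  calc dist1 (stairFamily W y r i) = dist1 ((stairFamily W y r i * (stairFamily W y r 0)⁻¹) * stairFamily W y r 0) := by rw [inv_mul_cancel_right]
    _ ≤ dist1 (stairFamily W y r i * (stairFamily W y r 0)⁻¹) + dist1 (stairFamily W y r 0) := GaugeGroup.dist1_mul_le _ _
    _ ≤ δ' + 3 * δ' := add_le_add (h' i) h0
    _ = 4 * δ' := by ring

/-! ## §2 (v1.1, APPEND-ONLY — §1 byte-identical)  The radial contour IS the staircase of the reversed axis order; hence the radial transporter of a `symCd`-axial field is near `1` -/

section Radial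

open Summit.QuantumFields.Balaban3D.Carriers (radialHol coordsDesc)
open Summit.QuantumFields.YangMills.BalabanUVNodes.N07SymContourData (permEnum)
open Summit.QuantumFields.YangMills.BalabanUVNodes.N07RadialHolCoverLift (radialHol_blockSite_eq_holAt_walk)
open B10Eq27TorusAxialLog (holT holT_eq_holAt)
open T4Continuum (stairWord stairRuns)

/-- The staircase word of the REVERSED axis order is NODE 00's staircase «last coordinate first» (`coordsDesc = (finRange d).reverse`). [cite: Balaban1987RG1, (0.3) p.252 (bookkeeping)] -/
theorem stairWord_revPerm_eq_stairRuns_coordsDesc {P : Params} (n : Fin P.d → ℤ) : stairWord Fin.revPerm n = stairRuns n (coordsDesc P) := by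
  unfold stairWord coordsDesc
  rw [List.finRange_reverse]
  rfl

/-- ★★ **THE RADIAL CONTOUR `Γ_{y,x}` OF RECORD IS A MEMBER OF THE (0.11) STAIR FAMILY** (standing range): the member indexed by the reversed axis order,
`stairFamily W y r (permEnum⁻¹ Fin.revPerm) = W(Γ_{y, blockSite y r})` — MODULE 86's `holT … (stairWord σ (off r))` at `σ = Fin.revPerm` is, by `holT_eq_holAt`, g9's staircase walk
`radialHol_blockSite_eq_holAt_walk`. [cite: Balaban1987RG1, (0.3) p.252; Balaban1984PropagatorsI, (1.7) p.18] -/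
theorem stairFamily_revPerm_eq_radialHol {P : Params} {j : ℕ} {G : Type*} [GaugeGroup G] (hj : j + 1 ≤ P.m + P.K) (W : GaugeField P j G) (y : Site P (j + 1))
    (r : Fin P.d → Fin P.L) : stairFamily W y r ((permEnum P).symm Fin.revPerm) = radialHol W y (Site.blockSite y r) := by
  unfold stairFamily
  rw [Equiv.apply_symm_apply, holT_eq_holAt, stairWord_revPerm_eq_stairRuns_coordsDesc, radialHol_blockSite_eq_holAt_walk hj]

/-- ★★★ **IN A `symCd`-AXIAL GAUGE THE RADIAL TRANSPORTER OF EVERY BLOCK SITE IS WITHIN `4δ′` OF `1`** — §1 at the radial member of §2: for `W` `symCd`-axial at level `n`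
(`n + 1 ≤ m + K`), `x = blockSite y r ≠ emb y`, stair family `δ_N`-small and within `δ′ ≤ 1∕100` of its member `0`: `dist1 (W(Γ_{y,x})) ≤ 4δ′`.  Read through the cover by g9's
`axialFn_avgIterZ_coverLift_eq_radialHol_of_small`, this is the averaged tree-transporter defect `δ₁(n) := 4δ′(n)` of the symmetric-convention gauge that ✓p754021
`B8TwoAxialGaugesOscillationRec` consumes. [cite: Balaban1987RG1, (0.3) p.252, (0.11) p.253, (0.5)–(0.7) p.253; Balaban1985Variational, (147) p.301] -/
theorem dist1_radialHol_le_of_axialGauge_symCd {K n : ℕ} (hn : n + 1 ≤ (F.P K).m + (F.P K).K) {W : GaugeField (F.P K) n (SU N)}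
    (hax : AxialGauge (symCd F N K n) W) (y : Site (F.P K) (n + 1)) (r : Fin (F.P K).d → Fin (F.P K).L) (hxy : Site.blockSite y r ≠ emb y)
    (hs : FamilySmall (FederbushMean.federbushSU (n := Fin N)).δ (stairFamily W y r)) {δ' : ℝ} (hδ' : δ' ≤ 1 / 100)
    (h' : ∀ i, dist1 (stairFamily W y r i * (stairFamily W y r 0)⁻¹) ≤ δ') :
    dist1 (radialHol W y (Site.blockSite y r)) ≤ 4 * δ' := by
  rw [← stairFamily_revPerm_eq_radialHol hn W y r]
  exact dist1_stairFamily_le_of_axialGauge_symCd hn hax y r hxy hs hδ' h' _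

end Radial

/-! ## §3 (v1.2, APPEND-ONLY — §1–§2 byte-identical)  The pairwise stair letter is GAUGE INVARIANT: read it in ANY gauge copy of the averaged field (e.g. the Landau copy) -/

section Invariance

open Summit.QuantumFields.YangMills.BalabanUVNodes.N07SymContourData (stairFamily_gaugeAct familySmall_stairFamily_gaugeAct_iff)
open GaugeField (gaugeAct)

variable {P : Params} {j : ℕ} {G : Type*} [GaugeGroup G]

/-- The pairwise distances of a stair family are GAUGE INVARIANT: the stairs of `W^u` are `u(emb y)·(stairs of W)·u(x)⁻¹` ([3] (11)), so `U_i·U_k⁻¹` is conjugated by `u(emb y)` and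
`dist1` is conjugation invariant. [cite: Balaban1985Averaging, (11) p.19; Balaban1987RG1, (0.5)–(0.7) p.253] -/
theorem dist1_stairFamily_mul_inv_gaugeAct (u : GaugeTransf P j G) (W : GaugeField P j G) (y : Site P (j + 1)) (r : Fin P.d → Fin P.L)
    (i k : Fin ((Nat.factorial P.d - 1) + 1)) :
    dist1 (stairFamily (gaugeAct u W) y r i * (stairFamily (gaugeAct u W) y r k)⁻¹) = dist1 (stairFamily W y r i * (stairFamily W y r k)⁻¹) := by
  simp only [stairFamily_gaugeAct]
  have h : u (emb y) * stairFamily W y r i * (u (Site.blockSite y r))⁻¹ * (u (emb y) * stairFamily W y r k * (u (Site.blockSite y r))⁻¹)⁻¹ =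
      u (emb y) * (stairFamily W y r i * (stairFamily W y r k)⁻¹) * (u (emb y))⁻¹ := by group
  rw [h, GaugeGroup.dist1_conj]

/-- ★★ **THE PAIRWISE STAIR LETTER OF `M^n(U^w)` IS THAT OF `M^n(U^u)` FOR ANY TWO GAUGES** (standing range; [3] (11) iterated, `T4Continuum.iter_gaugeAct`): the junction reads the
letter `δ′(n)` for the `symCd`-axial carrier `w_s` off ANY gauge copy — e.g. the def of record's Landau copy `U^u`, whose stairs dag-n07-e's chart letters bound.
[cite: Balaban1985Averaging, (11) p.19; Balaban1987RG1, (0.3) p.252, (0.5)–(0.7) p.253] -/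
theorem dist1_stairFamily_mul_inv_iter_gaugeAct (av : ∀ i, Averaging P i G) {n : ℕ} (hn : n ≤ P.m + P.K) (u w : GaugeTransf P 0 G) (U : GaugeField P 0 G)
    (y : Site P (n + 1)) (r : Fin P.d → Fin P.L) (i k : Fin ((Nat.factorial P.d - 1) + 1)) :
    dist1 (stairFamily (Averaging.iter av n (gaugeAct w U)) y r i * (stairFamily (Averaging.iter av n (gaugeAct w U)) y r k)⁻¹) =
      dist1 (stairFamily (Averaging.iter av n (gaugeAct u U)) y r i * (stairFamily (Averaging.iter av n (gaugeAct u U)) y r k)⁻¹) := by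
  rw [T4Continuum.iter_gaugeAct av w n hn U, T4Continuum.iter_gaugeAct av u n hn U, dist1_stairFamily_mul_inv_gaugeAct, dist1_stairFamily_mul_inv_gaugeAct]

/-- The Federbush guard transfers likewise between gauge copies of the averaged field. [cite: Balaban1987RG1, (0.5)–(0.7) p.253; Balaban1985Averaging, (11) p.19] -/
theorem familySmall_stairFamily_iter_gaugeAct_iff (av : ∀ i, Averaging P i G) {n : ℕ} (hn : n ≤ P.m + P.K) (δ : ℝ) (u w : GaugeTransf P 0 G) (U : GaugeField P 0 G)
    (y : Site P (n + 1)) (r : Fin P.d → Fin P.L) :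
    FamilySmall δ (stairFamily (Averaging.iter av n (gaugeAct w U)) y r) ↔ FamilySmall δ (stairFamily (Averaging.iter av n (gaugeAct u U)) y r) := by
  rw [T4Continuum.iter_gaugeAct av w n hn U, T4Continuum.iter_gaugeAct av u n hn U, familySmall_stairFamily_gaugeAct_iff, familySmall_stairFamily_gaugeAct_iff]

end Invariance

end Summit.QuantumFields.YangMills.BalabanUVNodes.N07SymAxialTreeDefect

end
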